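import Mathlib
import Summits.ResolutionOfSingularities.ResolutionOfSingularities.Theorems.RadicialJungCleanModelsPointCentreStepOfBase
import Summits.ResolutionOfSingularities.ResolutionOfSingularities.Theorems.RadicialJungCleanModelsContactChainL7bX44c
import Literature.AlgebraicGeometry.Resolution.RegularCentreBlowupSeqIntegral
import HarnessLib

/-!
# Route `RadicialJung`, crux `CleanModels` (stmt-ResolutionOfSingularities-15917), line `Sketch` rev 35, stub 6 `stub_cleanProp44` (X44c):
# both centre steps of [CoP1] Prop. 4.4 (clean version) ON A STAGE OF X44c, in the hypotheses of `stub_cleanProp44` verbatim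

Memo `Cruxes/CleanModels/Lines/Sketch-memo-hand2-g10-stubs-5-7.md` §3 («HOW O6 CALLS IT»).  `stub_cleanProp44` quantifies over: `S` integral Noetherian,
`char K(S) = p`, `S` regular excellent, `topologicalKrullDim S = 3`, the line of `G₀` clean-regular everywhere on `S`, `I ≠ ⊥`, a stage `ρ : X → S`
(`X` integral Noetherian, `IsCleanRegularCentreBlowupSeq p ρ I G₀`).  This file derives the base data of ✓ `exists_isCleanPermissibleSeq_blowup_curve_of_base` /
✓ `exists_isCleanPermissibleSeq_blowup_point_of_base` from exactly these (`X` regular ✓ `IsRegularCentreBlowupSeq.isRegular`, quasi-excellent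
✓ `.isQuasiExcellent`, `dim X ≤ 3` ✓ `.topologicalKrullDim_le`, line of `ρ^♯ G₀` clean-regular everywhere ✓ `IsCleanRegularCentreBlowupSeq.cleanRegAt`), so
that inside the clean-permissible sequence `π : X₁ → X` for `(J, μ)` under construction, O6 blows up a closed point or a regular curve of the stratum
`{ord J₁ = μ}` by ONE call: `X44cStage.blowup_point`, `X44cStage.blowup_curve`.

Honest framing: OURS (bookkeeping); the termination argument of X44c (O6) and O1–O5, O7 remain; nothing here proves X44c or any case of `CleanModels`.
-/

noncomputable section

set_option linter.dupNamespace false -- mandated namespace of this single-conjunct summit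

open CategoryTheory AlgebraicGeometry TopologicalSpace IsLocalRing Opposite
open Literature.AlgebraicGeometry.Resolution Literature.AlgebraicGeometry.Motives
open Scheme.IdealSheafData

namespace Summit.ResolutionOfSingularities.ResolutionOfSingularities.Theorems.RadicialJung.CleanModels

namespace X44cStage

/-- The base data of a stage of X44c: regular, quasi-excellent, of dimension `≤ 3`, line of `ρ^♯ G₀` clean-regular everywhere.
[cite: CossartPiltant2019, Prop. 4.4 (i)] [cite: Piltant2013, §2 Axioms 2 (ii) and 4] -/
theorem base_data (p : ℕ) [hp : Fact p.Prime] {S : Scheme.{0}} [IsIntegral S] [IsNoetherian S] [CharP S.functionField p]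
    (hS : Scheme.IsRegular S) (hE : Scheme.IsExcellent S) (hdimS : topologicalKrullDim S = 3) (G₀ : S.functionField)
    (hG₀ : ∀ s : S, CleanRegAt p (algebraMap (S.presheaf.stalk s) S.functionField) G₀) {I : S.IdealSheafData} (hI : I ≠ ⊥)
    {X : Scheme.{0}} {ρ : X ⟶ S} [IsIntegral X] [IsDominant ρ] (hρ : IsCleanRegularCentreBlowupSeq p ρ I G₀) :
    Scheme.IsRegular X ∧ Scheme.IsQuasiExcellent X ∧ topologicalKrullDim X ≤ 3 ∧ CharP X.functionField p ∧
      ∀ x : X, CleanRegAt p (algebraMap (X.presheaf.stalk x) X.functionField) (RatFn.functionFieldMap ρ G₀) := by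
  refine ⟨hρ.isRegularCentreBlowupSeq.isRegular hS, hρ.isRegularCentreBlowupSeq.isQuasiExcellent hE, ?_,
    charP_of_injective_ringHom (RatFn.functionFieldMap ρ).injective p, fun x => hρ.cleanRegAt hp.out inferInstance hG₀ x⟩
  exact hρ.isRegularCentreBlowupSeq.topologicalKrullDim_le inferInstance inferInstance hI (le_of_eq hdimS)

/-- **Curve-centre step on a stage of X44c.** [cite: CossartPiltant2008, Prop. 4.4 and Prop. 4.2 (a)] [cite: Piltant2013, §2 Axiom 4] -/
theorem blowup_curve (p : ℕ) [hp : Fact p.Prime] {S : Scheme.{0}} [IsIntegral S] [IsNoetherian S] [CharP S.functionField p]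
    (hS : Scheme.IsRegular S) (hE : Scheme.IsExcellent S) (hdimS : topologicalKrullDim S = 3) (G₀ : S.functionField)
    (hG₀ : ∀ s : S, CleanRegAt p (algebraMap (S.presheaf.stalk s) S.functionField) G₀) {I : S.IdealSheafData} (hI : I ≠ ⊥)
    {X : Scheme.{0}} {ρ : X ⟶ S} [IsIntegral X] [IsNoetherian X] [IsDominant ρ] (hρ : IsCleanRegularCentreBlowupSeq p ρ I G₀)
    {X₁ : Scheme.{0}} [IsIntegral X₁] {π : X₁ ⟶ X} [IsDominant π] {J : X.IdealSheafData} {μ : ℕ} {J₁ : X₁.IdealSheafData}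
    (hπ : IsCleanPermissibleSeq p π J μ J₁ (RatFn.functionFieldMap ρ G₀)) (hJ₁le : ∀ x : X₁, idealOrder J₁ x ≤ μ) {C₀ : Closeds X₁}
    (hC₀reg : ∀ y ∈ (C₀ : Set X₁), ∃ c : Fin 2 → X₁.presheaf.stalk y, IsRsopPart c ∧ Ideal.span (Set.range c) = stalkIdeal (vanishingIdeal C₀) y)
    {η : X₁} (hη : (C₀ : Set X₁) = closure {η}) (hC₀μ : ∀ y ∈ (C₀ : Set X₁), idealOrder J₁ y = μ) :
    ∃ (X' : Scheme.{0}) (_ : IsIntegral X') (_ : IsNoetherian X') (σ : X' ⟶ X₁) (_ : IsDominant σ) (C : Closeds X') (η' : X')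
      (J' : X'.IdealSheafData) (X'' : Scheme.{0}) (_ : IsIntegral X'') (_ : IsNoetherian X'') (τ : X'' ⟶ X') (_ : IsDominant τ),
      (C : Set X') = closure {η'} ∧ σ η' = η ∧
      (∀ y ∈ (C : Set X'), ∃ c : Fin 2 → X'.presheaf.stalk y, IsRsopPart c ∧ Ideal.span (Set.range c) = stalkIdeal (vanishingIdeal C) y) ∧
      (∀ y ∈ (C : Set X'), idealOrder J' y = μ) ∧ (∀ x' : X', idealOrder J' x' ≤ μ) ∧
      IsCleanPermissibleSeq p (σ ≫ π) J μ J' (RatFn.functionFieldMap ρ G₀) ∧ IsBlowup τ (vanishingIdeal C) ∧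
      IsCleanPermissibleSeq p (τ ≫ σ ≫ π) J μ (controlledTransform τ (vanishingIdeal C) J' μ) (RatFn.functionFieldMap ρ G₀) ∧
      ∀ x'' : X'', idealOrder (controlledTransform τ (vanishingIdeal C) J' μ) x'' ≤ μ := by
  obtain ⟨hX, hXE, hdim, hchar, hG⟩ := base_data p hS hE hdimS G₀ hG₀ hI hρ
  haveI := hchar
  exact exists_isCleanPermissibleSeq_blowup_curve_of_base p hπ hG hX hXE hdim hJ₁le hC₀reg hη hC₀μ

/-- **Point-centre step on a stage of X44c.** [cite: CossartPiltant2008, proof of Prop. 4.2] [cite: Piltant2013, §2 Axiom 2 (ii)] -/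
theorem blowup_point (p : ℕ) [hp : Fact p.Prime] {S : Scheme.{0}} [IsIntegral S] [IsNoetherian S] [CharP S.functionField p]
    (hS : Scheme.IsRegular S) (hE : Scheme.IsExcellent S) (hdimS : topologicalKrullDim S = 3) (G₀ : S.functionField)
    (hG₀ : ∀ s : S, CleanRegAt p (algebraMap (S.presheaf.stalk s) S.functionField) G₀) {I : S.IdealSheafData} (hI : I ≠ ⊥)
    {X : Scheme.{0}} {ρ : X ⟶ S} [IsIntegral X] [IsNoetherian X] [IsDominant ρ] (hρ : IsCleanRegularCentreBlowupSeq p ρ I G₀)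
    {X₁ : Scheme.{0}} [IsIntegral X₁] {π : X₁ ⟶ X} [IsDominant π] {J : X.IdealSheafData} {μ : ℕ} {J₁ : X₁.IdealSheafData}
    (hπ : IsCleanPermissibleSeq p π J μ J₁ (RatFn.functionFieldMap ρ G₀)) (hJ₁le : ∀ x : X₁, idealOrder J₁ x ≤ μ) {x : X₁}
    (hx : IsClosed ({x} : Set X₁)) (hord : idealOrder J₁ x = μ) (hmx : maximalIdeal (X₁.presheaf.stalk x) ≠ ⊥) :
    ∃ (X'' : Scheme.{0}) (_ : IsIntegral X'') (_ : IsNoetherian X'') (τ : X'' ⟶ X₁) (_ : IsDominant τ),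
      IsBlowup τ (vanishingIdeal (⟨{x}, hx⟩ : Closeds X₁)) ∧
      IsCleanPermissibleSeq p (τ ≫ π) J μ (controlledTransform τ (vanishingIdeal (⟨{x}, hx⟩ : Closeds X₁)) J₁ μ) (RatFn.functionFieldMap ρ G₀) ∧
      ∀ x'' : X'', idealOrder (controlledTransform τ (vanishingIdeal (⟨{x}, hx⟩ : Closeds X₁)) J₁ μ) x'' ≤ μ := by
  obtain ⟨hX, hXE, -, hchar, hG⟩ := base_data p hS hE hdimS G₀ hG₀ hI hρ
  haveI := hchar
  exact exists_isCleanPermissibleSeq_blowup_point_of_base p hπ hG hX hXE hJ₁le hx hord hmx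

/-- **Curve-centre step on a stage of X44c, for an IRREDUCIBLE regular curve piece** `Y` of the stratum `{ord J₁ = μ}` (the form of the regular-curve
pieces of the in-tree [CoP1] Prop. 4.4 assembly, `CP2008Prop44.stub_reach` / `stub_curve`): the generic point of `Y` is supplied by sobriety.
[cite: CossartPiltant2008, Prop. 4.4 and Prop. 4.2 (a)] [cite: Piltant2013, §2 Axiom 4] -/
theorem blowup_irreducible_curve (p : ℕ) [hp : Fact p.Prime] {S : Scheme.{0}} [IsIntegral S] [IsNoetherian S] [CharP S.functionField p]
    (hS : Scheme.IsRegular S) (hE : Scheme.IsExcellent S) (hdimS : topologicalKrullDim S = 3) (G₀ : S.functionField)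
    (hG₀ : ∀ s : S, CleanRegAt p (algebraMap (S.presheaf.stalk s) S.functionField) G₀) {I : S.IdealSheafData} (hI : I ≠ ⊥)
    {X : Scheme.{0}} {ρ : X ⟶ S} [IsIntegral X] [IsNoetherian X] [IsDominant ρ] (hρ : IsCleanRegularCentreBlowupSeq p ρ I G₀)
    {X₁ : Scheme.{0}} [IsIntegral X₁] {π : X₁ ⟶ X} [IsDominant π] {J : X.IdealSheafData} {μ : ℕ} {J₁ : X₁.IdealSheafData}
    (hπ : IsCleanPermissibleSeq p π J μ J₁ (RatFn.functionFieldMap ρ G₀)) (hJ₁le : ∀ x : X₁, idealOrder J₁ x ≤ μ) {Y : Closeds X₁}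
    (hirr : IsIrreducible (Y : Set X₁))
    (hYreg : ∀ y ∈ (Y : Set X₁), ∃ c : Fin 2 → X₁.presheaf.stalk y, IsRsopPart c ∧ Ideal.span (Set.range c) = stalkIdeal (vanishingIdeal Y) y)
    (hYμ : ∀ y ∈ (Y : Set X₁), idealOrder J₁ y = μ) :
    ∃ (X' : Scheme.{0}) (_ : IsIntegral X') (_ : IsNoetherian X') (σ : X' ⟶ X₁) (_ : IsDominant σ) (C : Closeds X') (η' : X')
      (J' : X'.IdealSheafData) (X'' : Scheme.{0}) (_ : IsIntegral X'') (_ : IsNoetherian X'') (τ : X'' ⟶ X') (_ : IsDominant τ),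
      (C : Set X') = closure {η'} ∧ σ η' ∈ (Y : Set X₁) ∧ closure {σ η'} = (Y : Set X₁) ∧
      (∀ y ∈ (C : Set X'), ∃ c : Fin 2 → X'.presheaf.stalk y, IsRsopPart c ∧ Ideal.span (Set.range c) = stalkIdeal (vanishingIdeal C) y) ∧
      (∀ y ∈ (C : Set X'), idealOrder J' y = μ) ∧ (∀ x' : X', idealOrder J' x' ≤ μ) ∧
      IsCleanPermissibleSeq p (σ ≫ π) J μ J' (RatFn.functionFieldMap ρ G₀) ∧ IsBlowup τ (vanishingIdeal C) ∧
      IsCleanPermissibleSeq p (τ ≫ σ ≫ π) J μ (controlledTransform τ (vanishingIdeal C) J' μ) (RatFn.functionFieldMap ρ G₀) ∧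
      ∀ x'' : X'', idealOrder (controlledTransform τ (vanishingIdeal C) J' μ) x'' ≤ μ := by
  -- the generic point of `Y`
  set η := hirr.genericPoint with hηdef
  have hηY : closure ({η} : Set X₁) = (Y : Set X₁) := hirr.closure_genericPoint Y.isClosed
  have hη : (Y : Set X₁) = closure {η} := hηY.symm
  obtain ⟨X', h1, h2, σ, h3, C, η', J', X'', h4, h5, τ, h6, hC, hση', hCreg, hCμ, hJ'le, hseq, hτ, hcons, hle⟩ :=
    blowup_curve p hS hE hdimS G₀ hG₀ hI hρ hπ hJ₁le hYreg hη hYμ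
  refine ⟨X', h1, h2, σ, h3, C, η', J', X'', h4, h5, τ, h6, hC, ?_, ?_, hCreg, hCμ, hJ'le, hseq, hτ, hcons, hle⟩
  · rw [hση', hη]; exact subset_closure rfl
  · rw [hση']; exact hηY

end X44cStage

end Summit.ResolutionOfSingularities.ResolutionOfSingularities.Theorems.RadicialJung.CleanModels

end
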